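import Mathlib.Analysis.Calculus.Deriv.MeanValue
import Mathlib.Analysis.ODE.Gronwall
import Mathlib.Analysis.ODE.ExistUnique
import Mathlib.Analysis.SpecialFunctions.Complex.Circle
import Mathlib.Topology.UniformSpace.HeineCantor
import Literature.Probability.RandomPlanarGeometry.LoewnerChainProofs
import HarnessLib

/-!
# The radial Loewner chain in the unit disc: solutions, swallowing times, hulls

Topic `Probability/RandomPlanarGeometry` (trunk T-STOCH). The **radial Loewner equation** in the
unit disc `𝔻` driven by a continuous function `U : ℝ≥0 → ℝ` (driving point `ξₜ = e^{iUₜ} ∈ ∂𝔻`),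
in the sign convention of Lawler–Schramm–Werner, *One-arm exponent for critical 2D percolation*,
Electron. J. Probab. **7** (2002), paper no. 2, eq. (2.5):
```
  ∂ₜ gₜ(z) = -gₜ(z) (gₜ(z) + ξₜ)/(gₜ(z) - ξₜ) = gₜ(z) (ξₜ + gₜ(z))/(ξₜ - gₜ(z)),   g₀(z) = z
```
(Lawler, *Conformally invariant processes in the plane* (2005), §4.2, eq. (4.11) with `a = 1`,
and §6.4 for radial `SLE_κ`, `Uₜ = √κ Bₜ`). This file is the radial counterpart of the chordal
prelude `LoewnerChain` / `LoewnerChainProofs` and follows their architecture line by line, with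
the imaginary part `im z` (the distance to the line carrying the singularity) replaced by
`1 - |z|²` (the unit circle carries `ξₜ`):

* `Disc.drivingPt U t = e^{iUₜ}`, the field `Disc.field U t z = z (ξₜ + z)/(ξₜ - z)`, solutions
  `Disc.IsSolution U z g T` (integral curves on `[0, T)` avoiding the singularity `gₜ ≠ ξₜ`; no
  condition `|g| < 1`, so boundary points `e^{iθ} ≠ ξ₀` genuinely flow on the circle until
  swallowed — the boundary process of LSW (2.9)), the swallowing time `Disc.swallowingTime U z`
  (a `WithTop ℝ≥0`, `sSup` of lifetimes), the hulls `Kₜ = {z ∈ 𝔻 | T_z ≤ t}` and domains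
  `Uₜ = 𝔻 ∖ Kₜ = {z ∈ 𝔻 | t < T_z}` (`Disc.hull`, `Disc.domain`), and the map `Disc.map U t`
  (by choice among solutions alive at `t`, junk value `z` after swallowing);
* the basic identity `Re((ξ + w)/(ξ - w)) = (1 - |w|²)/|ξ - w|²` (`re_add_div_sub`), whence along
  a solution `(|g|²)˙ = 2|g|²(1 - |g|²)/|ξ - g|²` (`IsSolution.hasDerivWithinAt_normSq`):
  `(1 - |gₜ|²)²` is non-increasing (`IsSolution.antitoneOn_sq_one_sub_normSq`), so **the circle
  is invariant** (`IsSolution.normSq_eq_one`), **the closed disc is invariant**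
  (`IsSolution.norm_le_one`), and every solution is bounded, `|gₜ| ≤ |z| + 2`
  (`IsSolution.norm_le`) — no continuity of `U` needed;
* for continuous `U`: the field is Lipschitz on `{δ ≤ |ξₜ - w|, |w| ≤ M}`
  (`lipschitzOnWith_field`), **uniqueness** (`IsSolution.eqOn`, Grönwall), **local existence**
  (`isPicardLindelof_field`, `exists_local_solution`, Picard–Lindelöf), **`0 < T_z` for
  `z ≠ ξ₀`** (`swallowingTime_pos`), **existence of the maximal solution**
  (`exists_isSolution_swallowingTime`), the **extension criterion** "`T_z` is the first time
  `|gₜ(z) - ξₜ|` reaches `0`" (`IsSolution.coe_lt_swallowingTime_of_le_norm_sub`,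
  `IsSolution.exists_norm_sub_lt`), **openness of `{z | t < T_z}`**
  (`isOpen_setOf_lt_swallowingTime`) and of the domains `Uₜ` (`isOpen_domain`), **the open disc
  is invariant** (`IsSolution.norm_lt_one`), `K₀ = ∅` (`hull_zero`), and the fixed point
  `gₜ(0) = 0`, `T_0 = ⊤` (`isSolution_zero`, `swallowingTime_zero`, `zero_mem_domain`).

The conformal-map half (LSW (2.6): `gₜ : Uₜ → 𝔻` is a conformal equivalence with `gₜ(0) = 0`,
`gₜ'(0) = eᵗ`) is in the sequel `RadialLoewnerFlow`. Everything here is proved; no named fact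
is introduced. The namespace `RadialLoewner.Disc` keeps these complex-plane objects apart from
the real boundary flow `RadialLoewner.arg` of `RadialBesselFlow`/`RadialBesselExit` (the process
`Yₜ` of LSW (2.9)–(2.11)), to which they are related in a further sequel.

## References

* G. F. Lawler, O. Schramm, W. Werner, *One-arm exponent for critical 2D percolation*, Electron.
  J. Probab. 7 (2002), no. 2, §2, eq. (2.5) [LawlerSchrammWernerEJP2002].
* G. F. Lawler, *Conformally Invariant Processes in the Plane*, AMS (2005), §4.2 (radial Loewner
  equation, eq. (4.11)–(4.12)), §4.1 (the chordal model of all proofs here) [Lawler2005].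

## Mathlib / tree

Mathlib: `IsIntegralCurveOn`, `IsPicardLindelof`, `ODE.FunSpace`, `dist_le_of_trajectories_ODE_of_mem`
(Grönwall), `antitoneOn_of_hasDerivWithinAt_nonpos`, `monotoneOn_of_hasDerivWithinAt_nonneg`,
`intermediate_value_Icc'`, `Complex.norm_exp_ofReal_mul_I`, `Complex.norm_exp_I_mul_ofReal_sub_one_le`.
Tree (chordal prelude, reused verbatim): `Loewner.ordConnected_timeDomain`,
`Loewner.mem_timeDomain_coe_iff`, `Loewner.Icc_subset_timeDomain`,
`Loewner.setOf_toNNReal_lt_mem_nhds`, `Loewner.exists_forall_mem_closedBall_of_isPicardLindelof`,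
`Loewner.exists_forall_abs_sub_driving_le`.
-/

noncomputable section

open Set Filter Topology Complex Metric
open scoped NNReal

namespace Literature.Probability.RandomPlanarGeometry

namespace RadialLoewner

namespace Disc

/-! ### The driving point, the radial field, solutions -/

/-- The time domain `[0, T)` of a solution with lifetime `T : WithTop ℝ≥0`, as a set of reals
(as in the chordal prelude `Loewner.IsSolution`). [folklore] -/
abbrev timeDom (T : WithTop ℝ≥0) : Set ℝ :=
  {t : ℝ | 0 ≤ t ∧ (t.toNNReal : WithTop ℝ≥0) < T}

/-- The **driving point** `ξₜ = e^{iUₜ}` on the unit circle (time `t : ℝ` read in `ℝ≥0` through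
`Real.toNNReal`, as in `Loewner.vectorField`). LSW (2002), (2.5): `ξₜ = e^{i√κ Bₜ}`.
[cite: LawlerSchrammWernerEJP2002, §2 eq. (2.5)] -/
def drivingPt (U : ℝ≥0 → ℝ) (t : ℝ) : ℂ :=
  Complex.exp ((U t.toNNReal : ℝ) * Complex.I)

/-- The **radial Loewner vector field** `F(t, z) = z (ξₜ + z)/(ξₜ - z)` (LSW (2002), (2.5):
`∂ₜ gₜ = -gₜ (gₜ + ξₜ)/(gₜ - ξₜ)`; junk value by `x / 0 = 0` at the singularity `z = ξₜ`, never
used since solutions avoid it). [cite: LawlerSchrammWernerEJP2002, §2 eq. (2.5)] -/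
def field (U : ℝ≥0 → ℝ) (t : ℝ) (z : ℂ) : ℂ :=
  z * (drivingPt U t + z) / (drivingPt U t - z)

/-- `IsSolution U z g T`: the curve `g : ℝ → ℂ` solves the radial Loewner equation
`ġ t = g t (ξₜ + g t)/(ξₜ - g t)` started at `g 0 = z` on `[0, T)`, staying off the
singularity: `g t ≠ ξₜ` there. No condition `|g t| < 1` is imposed (boundary points flow on the
circle). LSW (2002), (2.5); Lawler (2005), §4.2. [cite: LawlerSchrammWernerEJP2002, §2 eq. (2.5)] -/
def IsSolution (U : ℝ≥0 → ℝ) (z : ℂ) (g : ℝ → ℂ) (T : WithTop ℝ≥0) : Prop :=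
  g 0 = z ∧ IsIntegralCurveOn g (field U) (timeDom T) ∧
    ∀ t : ℝ, 0 ≤ t → (t.toNNReal : WithTop ℝ≥0) < T → g t ≠ drivingPt U t

/-- The **swallowing time** `T_z ∈ [0, ∞]` of `z` under the radial Loewner flow driven by `U`:
the supremum of the lifetimes of solutions started at `z` (`0` if there is none, e.g. `z = ξ₀`;
`⊤` if the solution is global, e.g. `z = 0`). Lawler (2005), §4.2; LSW (2002), §2 (the time `T`
at which a point is disconnected). [cite: Lawler2005, §4.2] -/
def swallowingTime (U : ℝ≥0 → ℝ) (z : ℂ) : WithTop ℝ≥0 :=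
  sSup {T | ∃ g, IsSolution U z g T}

/-- The **radial Loewner hull** `Kₜ = {z ∈ 𝔻 | T_z ≤ t}`: the points of the open unit disc
swallowed by time `t`. Lawler (2005), §4.2. [cite: Lawler2005, §4.2] -/
def hull (U : ℝ≥0 → ℝ) (t : ℝ≥0) : Set ℂ :=
  {z ∈ ball (0 : ℂ) 1 | swallowingTime U z ≤ t}

/-- The **radial Loewner domain** `Uₜ = 𝔻 ∖ Kₜ = {z ∈ 𝔻 | t < T_z}` (LSW (2002), §2: the
component `Uₜ` of `0` in `𝕌 ∖ γ[0, t]`, the domain of `gₜ`). [cite: LawlerSchrammWernerEJP2002, §2 (p. 5)] -/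
def domain (U : ℝ≥0 → ℝ) (t : ℝ≥0) : Set ℂ :=
  ball (0 : ℂ) 1 \ hull U t

open Classical in
/-- The **radial Loewner map** `gₜ : ℂ → ℂ`: for `z` admitting a solution alive beyond time `t`,
`map U t z = g t` (well defined for continuous `U` by uniqueness, `IsSolution.eqOn`); otherwise
the documented junk value `z`. LSW (2002), (2.5)–(2.6); Lawler (2005), §4.2.
[cite: LawlerSchrammWernerEJP2002, §2 eq. (2.5)] -/
def map (U : ℝ≥0 → ℝ) (t : ℝ≥0) (z : ℂ) : ℂ :=
  if h : ∃ p : (ℝ → ℂ) × WithTop ℝ≥0, IsSolution U z p.1 p.2 ∧ (t : WithTop ℝ≥0) < p.2 then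
    h.choose.1 t
  else z

/-! ### The driving point -/

section DrivingPt

variable (U : ℝ≥0 → ℝ)

/-- Unfolding of `drivingPt`. [folklore] -/
theorem drivingPt_apply (t : ℝ) : drivingPt U t = Complex.exp ((U t.toNNReal : ℝ) * Complex.I) :=
  rfl

/-- `|ξₜ| = 1`. [folklore] -/
@[simp] theorem norm_drivingPt (t : ℝ) : ‖drivingPt U t‖ = 1 :=
  Complex.norm_exp_ofReal_mul_I _

/-- `|ξₜ|² = 1`. [folklore] -/
@[simp] theorem normSq_drivingPt (t : ℝ) : Complex.normSq (drivingPt U t) = 1 := by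
  rw [Complex.normSq_eq_norm_sq, norm_drivingPt, one_pow]

/-- `ξₜ ≠ 0`. [folklore] -/
theorem drivingPt_ne_zero (t : ℝ) : drivingPt U t ≠ 0 :=
  Complex.exp_ne_zero _

/-- `ξ₀ = e^{iU₀}`. [folklore] -/
theorem drivingPt_zero : drivingPt U 0 = Complex.exp ((U 0 : ℝ) * Complex.I) := by
  rw [drivingPt_apply, Real.toNNReal_zero]

variable {U} in
/-- The driving point is continuous for a continuous driving function. [folklore] -/
theorem continuous_drivingPt (hU : Continuous U) : Continuous (drivingPt U) :=
  Complex.continuous_exp.comp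
    ((Complex.continuous_ofReal.comp (hU.comp continuous_real_toNNReal)).mul continuous_const)

/-- `|ξ_s - ξ_t| ≤ |U_s - U_t|` (the exponential map `ℝ → ∂𝔻` is `1`-Lipschitz). [folklore] -/
theorem norm_drivingPt_sub_le (s t : ℝ) :
    ‖drivingPt U s - drivingPt U t‖ ≤ |U s.toNNReal - U t.toNNReal| := by
  have h : drivingPt U s =
      drivingPt U t * Complex.exp (((U s.toNNReal - U t.toNNReal : ℝ) : ℂ) * Complex.I) := by
    rw [drivingPt_apply, drivingPt_apply, ← Complex.exp_add]
    congr 1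
    push_cast
    ring
  rw [h, ← mul_sub_one, norm_mul, norm_drivingPt, one_mul]
  have := Real.norm_exp_I_mul_ofReal_sub_one_le (x := U s.toNNReal - U t.toNNReal)
  rw [mul_comm] at this
  simpa [Real.norm_eq_abs] using this

/-- A point of the open disc is off the driving point. [folklore] -/
theorem ne_drivingPt_of_norm_lt_one {z : ℂ} (hz : ‖z‖ < 1) (t : ℝ) : z ≠ drivingPt U t := by
  rintro rfl
  simp at hz

end DrivingPt

/-! ### The field: algebra -/

section FieldAlgebra

variable (U : ℝ≥0 → ℝ) (t : ℝ)

/-- Unfolding of `field`. [folklore] -/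
theorem field_apply (z : ℂ) : field U t z = z * (drivingPt U t + z) / (drivingPt U t - z) := rfl

/-- The origin is a fixed point of the radial field. [folklore] -/
@[simp] theorem field_zero : field U t 0 = 0 := by
  simp [field_apply]

/-- `Re ((ξ + w)/(ξ - w)) = (1 - |w|²)/|ξ - w|²` for `|ξ| = 1` (the Poisson-kernel identity behind
`∂ₜ log |gₜ| > 0` inside the disc). [folklore] -/
theorem re_add_div_sub {ξ w : ℂ} (hξ : Complex.normSq ξ = 1) :
    ((ξ + w) / (ξ - w)).re = (1 - Complex.normSq w) / Complex.normSq (ξ - w) := by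
  rw [Complex.div_re, ← add_div]
  congr 1
  rw [Complex.normSq_apply] at hξ
  simp only [Complex.add_re, Complex.sub_re, Complex.add_im, Complex.sub_im, Complex.normSq_apply]
  linear_combination hξ

/-- `Re (w̄ F(t, w)) = |w|² (1 - |w|²)/|ξₜ - w|²`. [folklore] -/
theorem re_conj_mul_field (w : ℂ) :
    (starRingEnd ℂ w * field U t w).re =
      Complex.normSq w * ((1 - Complex.normSq w) / Complex.normSq (drivingPt U t - w)) := by
  have : starRingEnd ℂ w * field U t w =
      (Complex.normSq w : ℂ) * ((drivingPt U t + w) / (drivingPt U t - w)) := by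
    rw [field_apply, Complex.normSq_eq_conj_mul_self]
    ring
  rw [this, Complex.re_ofReal_mul, re_add_div_sub (normSq_drivingPt U t)]

variable {U t} in
/-- The difference identity
`F(w) - F(w') = (w - w') (ξ² + ξ (w + w') - w w')/((ξ - w)(ξ - w'))`. [folklore] -/
theorem field_sub_field {w w' : ℂ} (hw : drivingPt U t - w ≠ 0) (hw' : drivingPt U t - w' ≠ 0) :
    field U t w - field U t w' =
      (w - w') * (drivingPt U t ^ 2 + drivingPt U t * (w + w') - w * w') /
        ((drivingPt U t - w) * (drivingPt U t - w')) := by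
  rw [field_apply, field_apply, div_sub_div _ _ hw hw',
    div_eq_div_iff (mul_ne_zero hw hw') (mul_ne_zero hw hw')]
  ring

variable {U t} in
/-- Bound for the field away from the singularity: `|F(t, w)| ≤ M (1 + M)/δ` if `|ξₜ - w| ≥ δ > 0`
and `|w| ≤ M`. [folklore] -/
theorem norm_field_le {w : ℂ} {δ M : ℝ} (hδ : 0 < δ) (hw : δ ≤ ‖drivingPt U t - w‖)
    (hM : ‖w‖ ≤ M) : ‖field U t w‖ ≤ M * (1 + M) / δ := by
  have hM0 : 0 ≤ M := (norm_nonneg _).trans hM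
  have h1 : ‖drivingPt U t + w‖ ≤ 1 + M :=
    (norm_add_le _ _).trans (by rw [norm_drivingPt]; linarith)
  rw [field_apply, norm_div, norm_mul, div_le_div_iff₀ (hδ.trans_le hw) hδ]
  calc ‖w‖ * ‖drivingPt U t + w‖ * δ ≤ M * (1 + M) * δ := by gcongr
    _ ≤ M * (1 + M) * ‖drivingPt U t - w‖ := by gcongr

/-- **The radial field is Lipschitz away from the singularity on bounded sets**: on
`{w | δ ≤ |ξₜ - w|, |w| ≤ M}` it is `(1 + M)²/δ²`-Lipschitz (from `field_sub_field`). [folklore] -/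
theorem lipschitzOnWith_field {δ : ℝ≥0} (hδ : 0 < δ) (M : ℝ≥0) :
    LipschitzOnWith ((1 + M) ^ 2 / δ ^ 2) (field U t)
      {w : ℂ | (δ : ℝ) ≤ ‖drivingPt U t - w‖ ∧ ‖w‖ ≤ M} := by
  rw [lipschitzOnWith_iff_norm_sub_le]
  rintro w ⟨hw, hwM⟩ w' ⟨hw', hw'M⟩
  have hδ' : (0 : ℝ) < δ := hδ
  have h0 : drivingPt U t - w ≠ 0 := norm_pos_iff.1 (hδ'.trans_le hw)
  have h0' : drivingPt U t - w' ≠ 0 := norm_pos_iff.1 (hδ'.trans_le hw')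
  rw [field_sub_field h0 h0', norm_div, norm_mul, norm_mul]
  have hnum : ‖drivingPt U t ^ 2 + drivingPt U t * (w + w') - w * w'‖ ≤ (1 + (M : ℝ)) ^ 2 := by
    have e1 : ‖drivingPt U t ^ 2‖ = 1 := by rw [norm_pow, norm_drivingPt, one_pow]
    have e2 : ‖drivingPt U t * (w + w')‖ ≤ M + M := by
      rw [norm_mul, norm_drivingPt, one_mul]
      exact (norm_add_le _ _).trans (add_le_add hwM hw'M)
    have e3 : ‖w * w'‖ ≤ M * M := by
      rw [norm_mul]
      exact mul_le_mul hwM hw'M (norm_nonneg _) M.coe_nonneg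
    calc ‖drivingPt U t ^ 2 + drivingPt U t * (w + w') - w * w'‖
        ≤ ‖drivingPt U t ^ 2‖ + ‖drivingPt U t * (w + w')‖ + ‖w * w'‖ :=
          (norm_sub_le _ _).trans (add_le_add (norm_add_le _ _) le_rfl)
      _ ≤ 1 + (M + M) + M * M := by rw [e1]; gcongr
      _ = (1 + (M : ℝ)) ^ 2 := by ring
  have hden : (δ : ℝ) ^ 2 ≤ ‖drivingPt U t - w‖ * ‖drivingPt U t - w'‖ := by
    rw [sq]
    exact mul_le_mul hw hw' hδ'.le (norm_nonneg _)
  have hpos : 0 < ‖drivingPt U t - w‖ * ‖drivingPt U t - w'‖ := lt_of_lt_of_le (by positivity) hden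
  rw [div_le_iff₀ hpos, NNReal.coe_div, NNReal.coe_pow, NNReal.coe_pow, NNReal.coe_add,
    NNReal.coe_one]
  calc ‖w - w'‖ * ‖drivingPt U t ^ 2 + drivingPt U t * (w + w') - w * w'‖
      ≤ ‖w - w'‖ * (1 + (M : ℝ)) ^ 2 := by gcongr
    _ = (1 + (M : ℝ)) ^ 2 / (δ : ℝ) ^ 2 * ‖w - w'‖ * (δ : ℝ) ^ 2 := by field_simp
    _ ≤ (1 + (M : ℝ)) ^ 2 / (δ : ℝ) ^ 2 * ‖w - w'‖ *
        (‖drivingPt U t - w‖ * ‖drivingPt U t - w'‖) := by gcongr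

end FieldAlgebra

/-! ### Solutions: basic API and the evolution of `|gₜ|²` -/

section Flow

variable {U : ℝ≥0 → ℝ} {z : ℂ} {g g' : ℝ → ℂ} {T T' : WithTop ℝ≥0}

/-- A solution starts at `z`. [folklore] -/
theorem IsSolution.apply_zero (h : IsSolution U z g T) : g 0 = z := h.1

/-- A solution is an integral curve of the radial field on `[0, T)`. [folklore] -/
theorem IsSolution.isIntegralCurveOn (h : IsSolution U z g T) :
    IsIntegralCurveOn g (field U) (timeDom T) :=
  h.2.1

/-- A solution avoids the singularity: `g t ≠ ξₜ` on `[0, T)`. [folklore] -/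
theorem IsSolution.ne (h : IsSolution U z g T) {t : ℝ} (ht : 0 ≤ t)
    (htT : (t.toNNReal : WithTop ℝ≥0) < T) : g t ≠ drivingPt U t :=
  h.2.2 t ht htT

/-- Restricting the lifetime of a solution gives a solution. [folklore] -/
theorem IsSolution.mono (h : IsSolution U z g T) (hT : T' ≤ T) : IsSolution U z g T' :=
  ⟨h.1, h.2.1.mono fun _ ht ↦ ⟨ht.1, ht.2.trans_le hT⟩,
    fun t ht htT ↦ h.2.2 t ht (htT.trans_le hT)⟩

/-- The lifetime of a solution is bounded by the swallowing time. [folklore] -/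
theorem IsSolution.le_swallowingTime (h : IsSolution U z g T) : T ≤ swallowingTime U z :=
  le_sSup ⟨g, h⟩

/-- A solution is continuous on its time domain `[0, T)`. [folklore] -/
theorem IsSolution.continuousOn (h : IsSolution U z g T) : ContinuousOn g (timeDom T) :=
  fun t ht ↦ (h.isIntegralCurveOn t ht).continuousWithinAt

/-- `0 ∈ [0, T)` as soon as some `t ≥ 0` lies in it. [folklore] -/
theorem zero_mem_timeDom {t : ℝ} (htT : (t.toNNReal : WithTop ℝ≥0) < T) : (0 : ℝ) ∈ timeDom T :=
  ⟨le_rfl, lt_of_le_of_lt (WithTop.coe_le_coe.2 (by simp)) htT⟩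

/-- The derivative of `s ↦ |g s|²` along any differentiable curve: `2 Re(ḡ ġ)`. [folklore] -/
theorem hasDerivWithinAt_normSq_comp {f : ℝ → ℂ} {f' : ℂ} {D : Set ℝ} {s : ℝ}
    (h : HasDerivWithinAt f f' D s) :
    HasDerivWithinAt (fun s ↦ Complex.normSq (f s)) (2 * (starRingEnd ℂ (f s) * f').re) D s := by
  have hre : HasDerivWithinAt (fun s ↦ (f s).re) f'.re D s :=
    Complex.reCLM.hasFDerivAt.comp_hasDerivWithinAt s h
  have him : HasDerivWithinAt (fun s ↦ (f s).im) f'.im D s :=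
    Complex.imCLM.hasFDerivAt.comp_hasDerivWithinAt s h
  have heq : (fun s ↦ Complex.normSq (f s)) = fun s ↦ (f s).re * (f s).re + (f s).im * (f s).im := by
    funext u
    simp [Complex.normSq_apply]
  rw [heq]
  refine ((hre.fun_mul hre).fun_add (him.fun_mul him)).congr_deriv ?_
  simp only [Complex.mul_re, Complex.conj_re, Complex.conj_im]
  ring

/-- **Evolution of `|gₜ|²`** along a solution: `(|g|²)˙ = 2 |g|² (1 - |g|²)/|ξ - g|²`
(LSW (2002), (2.5): `∂ₜ log |gₜ| = Re((ξₜ + gₜ)/(ξₜ - gₜ))`, the Poisson kernel). No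
continuity of `U` is used. [cite: LawlerSchrammWernerEJP2002, §2 eq. (2.5)] -/
theorem IsSolution.hasDerivWithinAt_normSq (h : IsSolution U z g T) {s : ℝ} (hs : s ∈ timeDom T) :
    HasDerivWithinAt (fun s ↦ Complex.normSq (g s))
      (2 * (Complex.normSq (g s) *
        ((1 - Complex.normSq (g s)) / Complex.normSq (drivingPt U s - g s)))) (timeDom T) s := by
  have := hasDerivWithinAt_normSq_comp (h.isIntegralCurveOn s hs)
  rwa [re_conj_mul_field] at this

/-- **`(1 - |gₜ|²)²` is non-increasing** along every solution (its derivative is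
`-4 |g|² (1 - |g|²)²/|ξ - g|² ≤ 0`). [folklore] -/
theorem IsSolution.antitoneOn_sq_one_sub_normSq (h : IsSolution U z g T) :
    AntitoneOn (fun s ↦ (1 - Complex.normSq (g s)) ^ 2) (timeDom T) := by
  have hconv : Convex ℝ (timeDom T) := (Loewner.ordConnected_timeDomain T).convex
  have hu : ∀ s ∈ timeDom T, HasDerivWithinAt (fun s ↦ 1 - Complex.normSq (g s))
      (0 - 2 * (Complex.normSq (g s) *
        ((1 - Complex.normSq (g s)) / Complex.normSq (drivingPt U s - g s)))) (timeDom T) s :=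
    fun s hs ↦ (hasDerivWithinAt_const s _ 1).sub (h.hasDerivWithinAt_normSq hs)
  have hf : ∀ s ∈ timeDom T, HasDerivWithinAt (fun s ↦ (1 - Complex.normSq (g s)) ^ 2)
      (((2 : ℕ) : ℝ) * (1 - Complex.normSq (g s)) ^ (2 - 1) *
        (0 - 2 * (Complex.normSq (g s) *
          ((1 - Complex.normSq (g s)) / Complex.normSq (drivingPt U s - g s))))) (timeDom T) s :=
    fun s hs ↦ (hu s hs).pow 2
  refine antitoneOn_of_hasDerivWithinAt_nonpos hconv (fun s hs ↦ (hf s hs).continuousWithinAt)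
    (fun s hs ↦ (hf s (interior_subset hs)).mono interior_subset) fun s _ ↦ ?_
  have hN : 0 ≤ Complex.normSq (drivingPt U s - g s) := Complex.normSq_nonneg _
  have hρ : 0 ≤ Complex.normSq (g s) := Complex.normSq_nonneg _
  have : ((2 : ℕ) : ℝ) * (1 - Complex.normSq (g s)) ^ (2 - 1) *
      (0 - 2 * (Complex.normSq (g s) *
        ((1 - Complex.normSq (g s)) / Complex.normSq (drivingPt U s - g s)))) =
      -(4 * (Complex.normSq (g s) * (1 - Complex.normSq (g s)) ^ 2 /
        Complex.normSq (drivingPt U s - g s))) := by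
    norm_num
    ring
  rw [this, neg_nonpos]
  positivity

/-- `|1 - |gₜ|²| ≤ |1 - |z|²|` along every solution. [folklore] -/
theorem IsSolution.abs_one_sub_normSq_le (h : IsSolution U z g T) {t : ℝ} (ht : 0 ≤ t)
    (htT : (t.toNNReal : WithTop ℝ≥0) < T) :
    |1 - Complex.normSq (g t)| ≤ |1 - Complex.normSq z| := by
  have := h.antitoneOn_sq_one_sub_normSq (zero_mem_timeDom htT) ⟨ht, htT⟩ ht
  dsimp only at this
  rw [h.apply_zero] at this
  exact sq_le_sq.1 this

/-- **Every solution is bounded**: `|gₜ| ≤ |z| + 2` (from `|1 - |gₜ|²| ≤ |1 - |z|²|`).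
[folklore] -/
theorem IsSolution.norm_le (h : IsSolution U z g T) {t : ℝ} (ht : 0 ≤ t)
    (htT : (t.toNNReal : WithTop ℝ≥0) < T) : ‖g t‖ ≤ ‖z‖ + 2 := by
  have h1 := h.abs_one_sub_normSq_le ht htT
  rw [Complex.normSq_eq_norm_sq, Complex.normSq_eq_norm_sq] at h1
  have h3 := (abs_le.1 h1).1
  have h4 : |1 - ‖z‖ ^ 2| ≤ 1 + ‖z‖ ^ 2 :=
    abs_le.2 ⟨by nlinarith [sq_nonneg ‖z‖], by nlinarith [sq_nonneg ‖z‖]⟩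
  have h2 : ‖g t‖ ^ 2 ≤ (‖z‖ + 2) ^ 2 := by nlinarith [norm_nonneg z]
  exact (pow_le_pow_iff_left₀ (norm_nonneg _) (by positivity) two_ne_zero).1 h2

/-- **The unit circle is invariant**: a solution started on `∂𝔻` stays on `∂𝔻` (boundary points
flow on the circle; LSW (2002), (2.9): "`Yₜ` is the length of the arc on `∂𝕌` which corresponds
under `gₜ⁻¹` to …"). No continuity of `U` is used. [cite: LawlerSchrammWernerEJP2002, §2 eq. (2.9)] -/
theorem IsSolution.normSq_eq_one (h : IsSolution U z g T) (hz : ‖z‖ = 1) {t : ℝ} (ht : 0 ≤ t)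
    (htT : (t.toNNReal : WithTop ℝ≥0) < T) : Complex.normSq (g t) = 1 := by
  have h1 := h.abs_one_sub_normSq_le ht htT
  rw [Complex.normSq_eq_norm_sq z, hz, one_pow, sub_self, abs_zero] at h1
  have := abs_nonpos_iff.1 h1
  linarith

/-- On the circle: `|gₜ| = 1`. [folklore] -/
theorem IsSolution.norm_eq_one (h : IsSolution U z g T) (hz : ‖z‖ = 1) {t : ℝ} (ht : 0 ≤ t)
    (htT : (t.toNNReal : WithTop ℝ≥0) < T) : ‖g t‖ = 1 := by
  have := h.normSq_eq_one hz ht htT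
  rw [Complex.normSq_eq_norm_sq] at this
  exact (pow_eq_one_iff_of_nonneg (norm_nonneg _) two_ne_zero).1 this

/-- **The closed disc is invariant**: `|z| ≤ 1 ⟹ |gₜ| ≤ 1` (if `1 - |g|²` became negative it
would vanish in between, and `(1 - |g|²)²` is non-increasing). No continuity of `U` is used.
[folklore] -/
theorem IsSolution.normSq_le_one (h : IsSolution U z g T) (hz : ‖z‖ ≤ 1) {t : ℝ} (ht : 0 ≤ t)
    (htT : (t.toNNReal : WithTop ℝ≥0) < T) : Complex.normSq (g t) ≤ 1 := by
  by_contra hcon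
  rw [not_le] at hcon
  have hsub : Icc 0 t ⊆ timeDom T := Loewner.Icc_subset_timeDomain htT
  have hcont : ContinuousOn (fun s ↦ 1 - Complex.normSq (g s)) (Icc 0 t) :=
    continuousOn_const.sub (Complex.continuous_normSq.comp_continuousOn (h.continuousOn.mono hsub))
  have h0 : 0 ≤ 1 - Complex.normSq (g 0) := by
    rw [h.apply_zero, Complex.normSq_eq_norm_sq]
    nlinarith [norm_nonneg z]
  have ht' : 1 - Complex.normSq (g t) < 0 := by linarith
  obtain ⟨s, hs, hs0⟩ := intermediate_value_Icc' ht hcont ⟨ht'.le, h0⟩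
  have hanti := h.antitoneOn_sq_one_sub_normSq (hsub hs) (hsub ⟨ht, le_rfl⟩) hs.2
  dsimp only at hanti hs0
  rw [hs0] at hanti
  have h2 : (1 - Complex.normSq (g t)) ^ 2 = 0 := le_antisymm (by simpa using hanti) (sq_nonneg _)
  have := pow_eq_zero_iff (n := 2) two_ne_zero |>.1 h2
  linarith

/-- On the closed disc: `|gₜ| ≤ 1`. [folklore] -/
theorem IsSolution.norm_le_one (h : IsSolution U z g T) (hz : ‖z‖ ≤ 1) {t : ℝ} (ht : 0 ≤ t)
    (htT : (t.toNNReal : WithTop ℝ≥0) < T) : ‖g t‖ ≤ 1 := by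
  have := h.normSq_le_one hz ht htT
  rw [Complex.normSq_eq_norm_sq] at this
  exact (sq_le_one_iff₀ (norm_nonneg _)).1 this


/-! ### Uniqueness of the flow (continuous driving function) -/

/-- On a compact time interval `[0, b] ⊆ [0, T)` a solution stays a positive distance `δ` away
from the (continuous) driving point. [folklore] -/
theorem IsSolution.exists_le_norm_sub (hU : Continuous U) (h : IsSolution U z g T) {b : ℝ}
    (hb0 : 0 ≤ b) (hb : (b.toNNReal : WithTop ℝ≥0) < T) :
    ∃ δ : ℝ≥0, 0 < δ ∧ ∀ t ∈ Icc 0 b, (δ : ℝ) ≤ ‖drivingPt U t - g t‖ := by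
  have hsub : Icc 0 b ⊆ timeDom T := Loewner.Icc_subset_timeDomain hb
  have hcont : ContinuousOn (fun t ↦ ‖drivingPt U t - g t‖) (Icc 0 b) :=
    ((continuous_drivingPt hU).continuousOn.sub (h.continuousOn.mono hsub)).norm
  obtain ⟨t₀, ht₀, hmin⟩ :=
    (isCompact_Icc (a := (0 : ℝ)) (b := b)).exists_isMinOn (nonempty_Icc.2 hb0) hcont
  have hpos : 0 < ‖drivingPt U t₀ - g t₀‖ :=
    norm_pos_iff.2 (sub_ne_zero.2 (h.ne ht₀.1 (hsub ht₀).2).symm)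
  exact ⟨⟨‖drivingPt U t₀ - g t₀‖, hpos.le⟩, hpos, fun t ht ↦ hmin ht⟩

/-- One-sided derivatives of an integral curve: within `[t, ∞)` at every `t ∈ [0, b)` when
`[0, b] ⊆ D`. [folklore] -/
theorem hasDerivWithinAt_Ici_of_isIntegralCurveOn {D : Set ℝ} {f : ℝ → ℂ} {b : ℝ}
    (hD : Icc 0 b ⊆ D) (hf : IsIntegralCurveOn f (field U) D) :
    ∀ t ∈ Ico 0 b, HasDerivWithinAt f (field U t (f t)) (Ici t) t := by
  intro t ht
  have h1 : HasDerivWithinAt f (field U t (f t)) (Icc t b) t :=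
    (hf t (hD ⟨ht.1, ht.2.le⟩)).mono fun s hs ↦ hD ⟨ht.1.trans hs.1, hs.2⟩
  exact h1.mono_of_mem_nhdsWithin (Icc_mem_nhdsGE ht.2)

/-- One-sided derivatives of a solution within `[t, ∞)`, `t ∈ [0, b)`, `[0, b] ⊆ [0, T)`.
[folklore] -/
theorem IsSolution.hasDerivWithinAt_Ici (h : IsSolution U z g T) {b : ℝ}
    (hb : Icc 0 b ⊆ timeDom T) :
    ∀ t ∈ Ico 0 b, HasDerivWithinAt g (field U t (g t)) (Ici t) t :=
  hasDerivWithinAt_Ici_of_isIntegralCurveOn hb h.isIntegralCurveOn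

/-- **Uniqueness of the radial Loewner flow** for a continuous driving function: two solutions
started at `z` agree on `[0, min T T')`. On each compact `[0, b]` inside, both stay `δ`-away
from `ξ` (`IsSolution.exists_le_norm_sub`) and bounded by `|z| + 2` (`IsSolution.norm_le`), a
region where the field is Lipschitz (`lipschitzOnWith_field`); Grönwall
(`dist_le_of_trajectories_ODE_of_mem`) with initial distance `0` concludes. Lawler (2005), §4.1
(chordal model) / §4.2. [cite: Lawler2005, §4.2] -/
theorem IsSolution.eqOn (hU : Continuous U) (h : IsSolution U z g T) (h' : IsSolution U z g' T') :
    EqOn g g' (timeDom (min T T')) := by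
  intro b hb
  have hb0 : 0 ≤ b := hb.1
  have hbT : (b.toNNReal : WithTop ℝ≥0) < T := lt_of_lt_of_le hb.2 (min_le_left _ _)
  have hbT' : (b.toNNReal : WithTop ℝ≥0) < T' := lt_of_lt_of_le hb.2 (min_le_right _ _)
  obtain ⟨δ₁, hδ₁, hg⟩ := h.exists_le_norm_sub hU hb0 hbT
  obtain ⟨δ₂, hδ₂, hg'⟩ := h'.exists_le_norm_sub hU hb0 hbT'
  set δ : ℝ≥0 := min δ₁ δ₂ with hδdef
  have hδ : 0 < δ := lt_min hδ₁ hδ₂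
  have hδle₁ : (δ : ℝ) ≤ δ₁ := NNReal.coe_le_coe.2 (min_le_left _ _)
  have hδle₂ : (δ : ℝ) ≤ δ₂ := NNReal.coe_le_coe.2 (min_le_right _ _)
  set M : ℝ≥0 := ⟨‖z‖ + 2, by positivity⟩ with hMdef
  have hsub : Icc 0 b ⊆ timeDom T := Loewner.Icc_subset_timeDomain hbT
  have hsub' : Icc 0 b ⊆ timeDom T' := Loewner.Icc_subset_timeDomain hbT'
  have key := dist_le_of_trajectories_ODE_of_mem (v := field U)
    (s := fun t ↦ {w : ℂ | (δ : ℝ) ≤ ‖drivingPt U t - w‖ ∧ ‖w‖ ≤ M}) (K := (1 + M) ^ 2 / δ ^ 2)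
    (δ := 0) (f := g) (g := g') (a := 0) (b := b)
    (fun t _ ↦ lipschitzOnWith_field U t hδ M) (h.continuousOn.mono hsub)
    (h.hasDerivWithinAt_Ici hsub)
    (fun t ht ↦ ⟨hδle₁.trans (hg t ⟨ht.1, ht.2.le⟩), h.norm_le ht.1 (hsub ⟨ht.1, ht.2.le⟩).2⟩)
    (h'.continuousOn.mono hsub') (h'.hasDerivWithinAt_Ici hsub')
    (fun t ht ↦ ⟨hδle₂.trans (hg' t ⟨ht.1, ht.2.le⟩), h'.norm_le ht.1 (hsub' ⟨ht.1, ht.2.le⟩).2⟩)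
    (by rw [h.apply_zero, h'.apply_zero, dist_self])
  have := key b ⟨hb0, le_rfl⟩
  rw [zero_mul] at this
  exact dist_le_zero.1 this

/-! ### Local existence: Picard–Lindelöf for the radial field -/

/-- Lower bound for the distance to the singularity in a ball around a point `w₀` with
`δ ≤ |ξ_{t₀} - w₀|`, at times where the driving function has moved by at most `δ/4`: for
`|x - w₀| ≤ δ/2`, `|ξ_s - x| ≥ δ/4`. [folklore] -/
theorem norm_drivingPt_sub_ge {t₀ s : ℝ} {w₀ x : ℂ} {δ : ℝ}
    (hw₀ : δ ≤ ‖drivingPt U t₀ - w₀‖) (hs : |U s.toNNReal - U t₀.toNNReal| ≤ δ / 4)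
    (hx : ‖x - w₀‖ ≤ δ / 2) : δ / 4 ≤ ‖drivingPt U s - x‖ := by
  have h1 : ‖drivingPt U t₀ - w₀‖ ≤
      ‖drivingPt U s - x‖ + ‖x - w₀‖ + ‖drivingPt U s - drivingPt U t₀‖ := by
    calc ‖drivingPt U t₀ - w₀‖
        = ‖(drivingPt U s - x) + (x - w₀) - (drivingPt U s - drivingPt U t₀)‖ := by ring_nf
      _ ≤ ‖(drivingPt U s - x) + (x - w₀)‖ + ‖drivingPt U s - drivingPt U t₀‖ := norm_sub_le _ _
      _ ≤ _ := by gcongr; exact norm_add_le _ _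
  have h2 := norm_drivingPt_sub_le U s t₀
  linarith

/-- A point of the ball `|x - w₀| ≤ δ/2` has `|x| ≤ M` as soon as `|w₀| + δ/2 ≤ M`. [folklore] -/
theorem norm_le_of_mem_closedBall {w₀ x : ℂ} {δ M : ℝ} (hM : ‖w₀‖ + δ / 2 ≤ M)
    (hx : ‖x - w₀‖ ≤ δ / 2) : ‖x‖ ≤ M :=
  calc ‖x‖ = ‖(x - w₀) + w₀‖ := by rw [sub_add_cancel]
    _ ≤ ‖x - w₀‖ + ‖w₀‖ := norm_add_le _ _
    _ ≤ M := by linarith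

/-- **The radial field satisfies the Picard–Lindelöf hypotheses** near a point off the
singularity: if `δ ≤ |ξ_{t₀} - w₀|` (`δ > 0`), `|w₀| + δ/2 ≤ M`, the driving function moves by at
most `δ/4` on `[t₀, t₁]` and `(4M(1+M)/δ)(t₁ - t₀) ≤ δ/4`, then on `[t₀, t₁] × closedBall w₀ (δ/2)`
the field is bounded by `4M(1+M)/δ`, `(1+M)²/(δ/4)²`-Lipschitz and continuous in `t`, with
initial points allowed in `closedBall w₀ (δ/4)`. [folklore] -/
theorem isPicardLindelof_field (hU : Continuous U) {t₀ t₁ : ℝ} (ht : t₀ ≤ t₁) {w₀ : ℂ}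
    {δ M : ℝ≥0} (hδ : 0 < δ) (hw₀ : (δ : ℝ) ≤ ‖drivingPt U t₀ - w₀‖)
    (hM : ‖w₀‖ + δ / 2 ≤ M)
    (hmod : ∀ s ∈ Icc t₀ t₁, |U s.toNNReal - U t₀.toNNReal| ≤ δ / 4)
    (hlen : (4 * M * (1 + M) / δ : ℝ) * (t₁ - t₀) ≤ δ / 4) :
    IsPicardLindelof (field U) (⟨t₀, le_rfl, ht⟩ : Icc t₀ t₁) w₀ (δ / 2) (δ / 4)
      (4 * M * (1 + M) / δ) ((1 + M) ^ 2 / (δ / 4) ^ 2) where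
  lipschitzOnWith s hs := by
    refine (lipschitzOnWith_field U s (δ := δ / 4) (by positivity) M).mono fun x hx ↦ ?_
    have hx' : ‖x - w₀‖ ≤ δ / 2 := by simpa [dist_eq_norm] using hx
    refine ⟨?_, norm_le_of_mem_closedBall hM hx'⟩
    simpa using norm_drivingPt_sub_ge hw₀ (hmod s hs) hx'
  continuousOn x hx := by
    have hx' : ‖x - w₀‖ ≤ δ / 2 := by simpa [dist_eq_norm] using hx
    have hc := continuous_drivingPt hU
    refine ContinuousOn.div (continuousOn_const.mul (hc.continuousOn.add continuousOn_const))
      (hc.continuousOn.sub continuousOn_const) ?_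
    intro s hs h0
    have hge := norm_drivingPt_sub_ge hw₀ (hmod s hs) hx'
    rw [h0, norm_zero] at hge
    have : (0 : ℝ) < δ := hδ
    linarith
  norm_le s hs x hx := by
    have hx' : ‖x - w₀‖ ≤ δ / 2 := by simpa [dist_eq_norm] using hx
    have hge := norm_drivingPt_sub_ge hw₀ (hmod s hs) hx'
    have hxM := norm_le_of_mem_closedBall hM hx'
    have hδ' : (0 : ℝ) < δ := hδ
    have := norm_field_le (by positivity : (0 : ℝ) < δ / 4) hge hxM
    calc ‖field U s x‖ ≤ M * (1 + M) / (δ / 4) := this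
      _ = ((4 * M * (1 + M) / δ : ℝ≥0) : ℝ) := by push_cast; field_simp
  mul_max_le := by
    have hmax : max (t₁ - t₀) (t₀ - t₀) = t₁ - t₀ := by
      rw [sub_self]
      exact max_eq_left (sub_nonneg.2 ht)
    rw [hmax]
    push_cast
    linarith

/-- **Local solutions of the radial Loewner equation** near a point off the singularity, from
any nearby initial point: under the hypotheses of `isPicardLindelof_field`, for every `x` with
`|x - w₀| ≤ δ/4` there is a solution `α` on `[t₀, t₁]` with `α t₀ = x`, staying in
`closedBall w₀ (δ/2)` and hence at distance `≥ δ/4` from the driving point. (Picard–Lindelöf;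
Lawler (2005), §4.1/§4.2.) [cite: Lawler2005, §4.2] -/
theorem exists_local_solution (hU : Continuous U) {t₀ t₁ : ℝ} (ht : t₀ ≤ t₁) {w₀ : ℂ}
    {δ M : ℝ≥0} (hδ : 0 < δ) (hw₀ : (δ : ℝ) ≤ ‖drivingPt U t₀ - w₀‖) (hM : ‖w₀‖ + δ / 2 ≤ M)
    (hmod : ∀ s ∈ Icc t₀ t₁, |U s.toNNReal - U t₀.toNNReal| ≤ δ / 4)
    (hlen : (4 * M * (1 + M) / δ : ℝ) * (t₁ - t₀) ≤ δ / 4) {x : ℂ} (hx : ‖x - w₀‖ ≤ δ / 4) :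
    ∃ α : ℝ → ℂ, α t₀ = x ∧ (∀ s ∈ Icc t₀ t₁, (δ : ℝ) / 4 ≤ ‖drivingPt U s - α s‖) ∧
      (∀ s, ‖α s - w₀‖ ≤ δ / 2) ∧
      ∀ s ∈ Icc t₀ t₁, HasDerivWithinAt α (field U s (α s)) (Icc t₀ t₁) s := by
  have hPL := isPicardLindelof_field hU ht hδ hw₀ hM hmod hlen
  obtain ⟨α, hα0, hball, hder⟩ := Loewner.exists_forall_mem_closedBall_of_isPicardLindelof hPL
    (x := x) (by simpa [dist_eq_norm] using hx)
  have hball' : ∀ s, ‖α s - w₀‖ ≤ δ / 2 := fun s ↦ by simpa [dist_eq_norm] using hball s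
  exact ⟨α, hα0, fun s hs ↦ norm_drivingPt_sub_ge hw₀ (hmod s hs) (hball' s), hball', hder⟩

/-- **Every point `z ≠ ξ₀` flows for a positive time**: `0 < T_z` (a local solution on a short
interval `[0, ε]` exists by Picard–Lindelöf). Lawler (2005), §4.2; LSW (2002), (2.5).
[cite: Lawler2005, §4.2] -/
theorem swallowingTime_pos (hU : Continuous U) (hz : z ≠ drivingPt U 0) :
    0 < swallowingTime U z := by
  have hδpos : 0 < ‖drivingPt U 0 - z‖ := norm_pos_iff.2 (sub_ne_zero.2 hz.symm)
  set δ : ℝ≥0 := ⟨‖drivingPt U 0 - z‖, hδpos.le⟩ with hδdef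
  have hδ : 0 < δ := hδpos
  have hδ' : (0 : ℝ) < δ := hδpos
  set M : ℝ≥0 := ⟨‖z‖ + δ / 2, by positivity⟩ with hMdef
  have hM : ‖z‖ + δ / 2 ≤ M := le_rfl
  have hM' : (0 : ℝ) < M := by
    change (0 : ℝ) < ‖z‖ + δ / 2
    positivity
  set L : ℝ := 4 * M * (1 + M) / δ with hLdef
  have hL : 0 < L := by positivity
  obtain ⟨ε₁, hε₁, hmod₁⟩ :=
    Loewner.exists_forall_abs_sub_driving_le hU 1 (η := δ / 4) (by positivity)
  set ε : ℝ := min (min ε₁ 1) (δ / 4 / L) with hεdef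
  have hε : 0 < ε := lt_min (lt_min hε₁ one_pos) (by positivity)
  have hε₁' : ε ≤ ε₁ := (min_le_left _ _).trans (min_le_left _ _)
  have hε1 : ε ≤ 1 := (min_le_left _ _).trans (min_le_right _ _)
  have hεL : ε ≤ δ / 4 / L := min_le_right _ _
  have hw₀ : (δ : ℝ) ≤ ‖drivingPt U 0 - z‖ := le_rfl
  have hmod : ∀ s ∈ Icc (0 : ℝ) ε, |U s.toNNReal - U (0 : ℝ).toNNReal| ≤ δ / 4 := fun s hs ↦
    hmod₁ s ⟨hs.1, hs.2.trans hε1⟩ 0 ⟨le_rfl, zero_le_one⟩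
      (by rw [sub_zero, abs_of_nonneg hs.1]; exact hs.2.trans hε₁')
  have hlen : L * (ε - 0) ≤ δ / 4 := by
    rw [sub_zero, mul_comm]
    exact (le_div_iff₀ hL).1 hεL
  obtain ⟨α, hα0, hfar, -, hder⟩ :=
    exists_local_solution hU hε.le hδ hw₀ hM hmod hlen (x := z) (by simp; positivity)
  -- `α` is a solution with lifetime `ε/2`
  set b : ℝ≥0 := ⟨ε / 2, (half_pos hε).le⟩ with hbdef
  have hsub : timeDom (b : WithTop ℝ≥0) ⊆ Icc 0 ε := by
    intro t ht
    have ht' := Loewner.mem_timeDomain_coe_iff.1 ht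
    have ht2 : t < ε / 2 := ht'.2
    exact ⟨ht'.1, by linarith⟩
  have hsol : IsSolution U z α b := by
    refine ⟨hα0, fun t ht ↦ (hder t (hsub ht)).mono hsub, fun t ht htb h0 ↦ ?_⟩
    have := hfar t (hsub ⟨ht, htb⟩)
    rw [h0, sub_self, norm_zero] at this
    linarith
  calc (0 : WithTop ℝ≥0) < b := by
        rw [← WithTop.coe_zero, WithTop.coe_lt_coe]
        exact half_pos hε
    _ ≤ swallowingTime U z := hsol.le_swallowingTime

/-! ### The maximal solution -/

/-- **Existence of the maximal solution** of the radial Loewner equation for a continuous driving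
function: for each `t < T_z` some solution is alive at `t`; by uniqueness (`IsSolution.eqOn`)
these agree where jointly defined, so patching them defines a solution on all of `[0, T_z)`.
Lawler (2005), §4.2. [cite: Lawler2005, §4.2] -/
theorem exists_isSolution_swallowingTime (hU : Continuous U) (z : ℂ) :
    ∃ g, IsSolution U z g (swallowingTime U z) := by
  classical
  set D : Set ℝ := timeDom (swallowingTime U z) with hD
  have hex : ∀ t : ℝ, t ∈ D → ∃ p : (ℝ → ℂ) × WithTop ℝ≥0, IsSolution U z p.1 p.2 ∧
      (t.toNNReal : WithTop ℝ≥0) < p.2 := by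
    intro t ht
    obtain ⟨T', ⟨g', hg'⟩, htT'⟩ := lt_sSup_iff.1 ht.2
    exact ⟨(g', T'), hg', htT'⟩
  choose! p hp using hex
  refine ⟨fun t ↦ if t ∈ D then (p t).1 t else z, ?_, fun t ht ↦ ?_, fun t ht htT ↦ ?_⟩
  · by_cases h0 : (0 : ℝ) ∈ D
    · simp only [h0, if_true]
      exact (hp 0 h0).1.apply_zero
    · simp only [h0, if_false]
  · obtain ⟨hsol, htt⟩ := hp t ht
    have hagree : ∀ s ∈ D ∩ {s : ℝ | (s.toNNReal : WithTop ℝ≥0) < (p t).2},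
        (if s ∈ D then (p s).1 s else z) = (p t).1 s := by
      rintro s ⟨hsD, hsT⟩
      rw [if_pos hsD]
      obtain ⟨hsol', hss⟩ := hp s hsD
      exact IsSolution.eqOn hU hsol' hsol ⟨hsD.1, lt_min hss hsT⟩
    have hmem : D ∩ {s : ℝ | (s.toNNReal : WithTop ℝ≥0) < (p t).2} ∈ 𝓝[D] t :=
      inter_mem_nhdsWithin D (Loewner.setOf_toNNReal_lt_mem_nhds htt)
    have h1 : HasDerivWithinAt (p t).1 (field U t ((p t).1 t))
        (D ∩ {s : ℝ | (s.toNNReal : WithTop ℝ≥0) < (p t).2}) t :=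
      (hsol.isIntegralCurveOn t ⟨ht.1, htt⟩).mono fun s hs ↦ ⟨hs.1.1, hs.2⟩
    have h2 : HasDerivWithinAt (fun s ↦ if s ∈ D then (p s).1 s else z)
        (field U t ((p t).1 t)) (D ∩ {s : ℝ | (s.toNNReal : WithTop ℝ≥0) < (p t).2}) t :=
      h1.congr (fun s hs ↦ hagree s hs) (hagree t ⟨ht, htt⟩)
    have hGt : (if t ∈ D then (p t).1 t else z) = (p t).1 t := hagree t ⟨ht, htt⟩
    dsimp only
    rw [hGt]
    exact h2.mono_of_mem_nhdsWithin hmem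
  · dsimp only
    rw [if_pos (show t ∈ D from ⟨ht, htT⟩)]
    obtain ⟨hsol, htt⟩ := hp t ⟨ht, htT⟩
    exact hsol.ne ht htt

/-- No flow starts at the singularity: `T_{ξ₀} ≤ 0`. [folklore] -/
theorem swallowingTime_drivingPt_le (U : ℝ≥0 → ℝ) : swallowingTime U (drivingPt U 0) ≤ 0 := by
  refine sSup_le fun T ⟨g, hg⟩ ↦ not_lt.1 fun hT ↦ ?_
  have h := hg.ne le_rfl (by simpa using hT)
  rw [hg.apply_zero] at h
  exact h rfl

/-- A point with positive swallowing time is off the singularity. [folklore] -/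
theorem ne_drivingPt_of_lt_swallowingTime {t : WithTop ℝ≥0} (h : t < swallowingTime U z) :
    z ≠ drivingPt U 0 := by
  rintro rfl
  have := h.trans_le (swallowingTime_drivingPt_le U)
  exact not_lt_bot (this.trans_le bot_le.ge)

/-! ### Extension past a regular endpoint; openness of `{z | t < T_z}` -/

/-- **Extension past a regular endpoint.** A solution with finite lifetime `b > 0` that stays
`δ`-away (`δ > 0`) from the (continuous) driving point on `[0, b)` is not maximal: `b < T_z`
(restart at `t₀ = b - ε/2` from `g t₀` by `exists_local_solution` and glue). This is the
extension criterion behind "`T` is the first time `gₜ(z)` reaches `ξₜ`" (Lawler (2005), §4.2;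
LSW (2002), p. 5: the disconnection time). [cite: Lawler2005, §4.2] -/
theorem IsSolution.coe_lt_swallowingTime_of_le_norm_sub (hU : Continuous U) {b : ℝ≥0}
    (hb : 0 < b) (h : IsSolution U z g b) {δ : ℝ≥0} (hδ : 0 < δ)
    (hfar : ∀ t : ℝ, 0 ≤ t → t < b → (δ : ℝ) ≤ ‖drivingPt U t - g t‖) :
    (b : WithTop ℝ≥0) < swallowingTime U z := by
  have hδ' : (0 : ℝ) < δ := hδ
  have hb' : (0 : ℝ) < b := hb
  -- the bound `M` for the restart and the speed `L`
  set M : ℝ≥0 := ⟨‖z‖ + 2 + δ / 2, by positivity⟩ with hMdef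
  have hM' : (0 : ℝ) < M := by
    change (0 : ℝ) < ‖z‖ + 2 + δ / 2
    positivity
  set L : ℝ := 4 * M * (1 + M) / δ with hLdef
  have hL : 0 < L := by positivity
  -- uniform continuity of `U` on `[0, b + 1]`, and the small time step `ε`
  obtain ⟨ε₁, hε₁, hmod₁⟩ :=
    Loewner.exists_forall_abs_sub_driving_le hU ((b : ℝ) + 1) (η := δ / 4) (by positivity)
  set ε : ℝ := min (min ε₁ 1) (min (b : ℝ) (δ / 4 / L)) with hεdef
  have hε : 0 < ε := lt_min (lt_min hε₁ one_pos) (lt_min hb' (by positivity))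
  have hε₁' : ε ≤ ε₁ := (min_le_left _ _).trans (min_le_left _ _)
  have hε1 : ε ≤ 1 := (min_le_left _ _).trans (min_le_right _ _)
  have hεb : ε ≤ b := (min_le_right _ _).trans (min_le_left _ _)
  have hεL : ε ≤ δ / 4 / L := (min_le_right _ _).trans (min_le_right _ _)
  set t₀ : ℝ := b - ε / 2 with ht₀def
  set t₁ : ℝ := t₀ + ε with ht₁def
  have ht₀0 : 0 ≤ t₀ := by rw [ht₀def]; linarith
  have ht₀b : t₀ < b := by rw [ht₀def]; linarith
  have ht₁b : t₁ = b + ε / 2 := by rw [ht₁def, ht₀def]; ring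
  have ht₀₁ : t₀ ≤ t₁ := by rw [ht₁def]; linarith
  -- the local solution from `g t₀` at time `t₀`
  have hw₀ : (δ : ℝ) ≤ ‖drivingPt U t₀ - g t₀‖ := hfar t₀ ht₀0 ht₀b
  have ht₀T : (t₀.toNNReal : WithTop ℝ≥0) < (b : WithTop ℝ≥0) :=
    (Loewner.mem_timeDomain_coe_iff.2 ⟨ht₀0, ht₀b⟩).2
  have hM : ‖g t₀‖ + δ / 2 ≤ M := by
    change ‖g t₀‖ + δ / 2 ≤ ‖z‖ + 2 + δ / 2
    linarith [h.norm_le ht₀0 ht₀T]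
  have hmod : ∀ s ∈ Icc t₀ t₁, |U s.toNNReal - U t₀.toNNReal| ≤ δ / 4 := fun s hs ↦
    hmod₁ s ⟨ht₀0.trans hs.1, by rw [ht₁b] at hs; linarith [hs.2]⟩ t₀ ⟨ht₀0, by linarith⟩
      (by rw [abs_of_nonneg (by linarith [hs.1]), ht₁def] at *; linarith [hs.2])
  have hlen : L * (t₁ - t₀) ≤ δ / 4 := by
    rw [show t₁ - t₀ = ε by rw [ht₁def]; ring, mul_comm]
    exact (le_div_iff₀ hL).1 hεL
  obtain ⟨α, hα0, hαfar, -, hαder⟩ :=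
    exists_local_solution hU ht₀₁ hδ hw₀ hM hmod hlen (x := g t₀) (by simp; positivity)
  -- glue `g` (up to `t₀`) and `α` (after `t₀`)
  set G : ℝ → ℂ := fun s ↦ if s ≤ t₀ then g s else α s with hGdef
  have hb'pos : (0 : ℝ) ≤ b + ε / 2 := by linarith
  set b' : ℝ≥0 := ⟨(b : ℝ) + ε / 2, hb'pos⟩ with hb'def
  set D : Set ℝ := timeDom (b : WithTop ℝ≥0) with hDdef
  set D' : Set ℝ := timeDom (b' : WithTop ℝ≥0) with hD'def
  have hD'iff : ∀ s, s ∈ D' ↔ 0 ≤ s ∧ s < b + ε / 2 := fun s ↦ Loewner.mem_timeDomain_coe_iff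
  have hDiff : ∀ s, s ∈ D ↔ 0 ≤ s ∧ s < b := fun s ↦ Loewner.mem_timeDomain_coe_iff
  have hGg : EqOn G g (Iic t₀) := fun s hs ↦ if_pos hs
  have hGα : EqOn G α (Ici t₀) := fun s hs ↦ by
    rcases eq_or_lt_of_le (show t₀ ≤ s from hs) with heq | hs'
    · rw [← heq]
      show (if t₀ ≤ t₀ then g t₀ else α t₀) = α t₀
      rw [if_pos le_rfl, hα0]
    · exact if_neg (not_le.2 hs')
  -- derivative of `G` from the left of `t₀` (including at `t₀`)
  have hleft : ∀ s, 0 ≤ s → s ≤ t₀ →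
      HasDerivWithinAt G (field U s (g s)) (D' ∩ Iic t₀) s := by
    intro s hs0 hst
    have hsub : D' ∩ Iic t₀ ⊆ D := fun u hu ↦ (hDiff u).2 ⟨hu.1.1, lt_of_le_of_lt hu.2 ht₀b⟩
    have h1 : HasDerivWithinAt g (field U s (g s)) (D' ∩ Iic t₀) s :=
      (h.isIntegralCurveOn s ((hDiff s).2 ⟨hs0, lt_of_le_of_lt hst ht₀b⟩)).mono hsub
    exact h1.congr (fun u hu ↦ hGg hu.2) (hGg hst)
  -- derivative of `G` from the right of `t₀` (including at `t₀`)
  have hright : ∀ s, t₀ ≤ s → s < b + ε / 2 →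
      HasDerivWithinAt G (field U s (α s)) (D' ∩ Ici t₀) s := by
    intro s hst hsb
    have hsub : D' ∩ Ici t₀ ⊆ Icc t₀ t₁ := fun u hu ↦
      ⟨hu.2, by rw [ht₁b]; exact ((hD'iff u).1 hu.1).2.le⟩
    have h1 : HasDerivWithinAt α (field U s (α s)) (D' ∩ Ici t₀) s :=
      (hαder s ⟨hst, by rw [ht₁b]; exact hsb.le⟩).mono hsub
    exact h1.congr (fun u hu ↦ hGα hu.2) (hGα hst)
  have hsolG : IsSolution U z G b' := by
    refine ⟨?_, fun s hs ↦ ?_, fun s hs hsb h0 ↦ ?_⟩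
    · rw [hGg ht₀0, h.apply_zero]
    · have hs' := (hD'iff s).1 hs
      rcases lt_trichotomy s t₀ with hlt | heq | hgt
      · have h1 := hleft s hs'.1 hlt.le
        rw [← hGg hlt.le] at h1
        exact h1.mono_of_mem_nhdsWithin (inter_mem_nhdsWithin D' (Iic_mem_nhds hlt))
      · have h1 := hleft s hs'.1 heq.le
        have h2 := hright s heq.ge hs'.2
        rw [(hGg heq.le).symm] at h1
        rw [(hGα (show t₀ ≤ s from heq.ge)).symm] at h2
        have h3 := h1.union h2
        rwa [← inter_union_distrib_left, Iic_union_Ici, inter_univ] at h3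
      · have h1 := hright s hgt.le hs'.2
        rw [← hGα (show t₀ ≤ s from hgt.le)] at h1
        exact h1.mono_of_mem_nhdsWithin
          (inter_mem_nhdsWithin D' (mem_of_superset (Ioi_mem_nhds hgt) Ioi_subset_Ici_self))
    · have hsb' : s < b + ε / 2 := ((hD'iff s).1 ⟨hs, hsb⟩).2
      rcases le_or_gt s t₀ with hst | hst
      · have hfar' := hfar s hs (lt_of_le_of_lt hst ht₀b)
        rw [← hGg hst, h0, sub_self, norm_zero] at hfar'
        linarith
      · have hfar' := hαfar s ⟨hst.le, by rw [ht₁b]; exact hsb'.le⟩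
        rw [← hGα hst.le, h0, sub_self, norm_zero] at hfar'
        linarith
  calc (b : WithTop ℝ≥0) < b' := by
        rw [WithTop.coe_lt_coe, ← NNReal.coe_lt_coe]
        show (b : ℝ) < b + ε / 2
        linarith
    _ ≤ swallowingTime U z := hsolG.le_swallowingTime

/-- **The maximal solution with finite lifetime approaches the driving point**: if `g` solves
the radial Loewner equation on `[0, T_z)` with `T_z = b` finite and positive, then for every
`δ > 0` some `t ∈ [0, b)` has `|ξₜ - g t| < δ` (contrapositive of
`IsSolution.coe_lt_swallowingTime_of_le_norm_sub`). LSW (2002), p. 5 ("At time `T`, `γ`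
separates `0` from `e^{iθ}`"): `T` is the first time `gₜ(e^{iθ})` meets `ξₜ`.
[cite: LawlerSchrammWernerEJP2002, §2 (p. 5)] -/
theorem IsSolution.exists_norm_sub_lt (hU : Continuous U) {b : ℝ≥0} (hb : 0 < b)
    (h : IsSolution U z g b) (hmax : swallowingTime U z = b) {δ : ℝ} (hδ : 0 < δ) :
    ∃ t : ℝ, 0 ≤ t ∧ t < b ∧ ‖drivingPt U t - g t‖ < δ := by
  by_contra hcon
  have hcon' : ∀ t : ℝ, 0 ≤ t → t < b → ((⟨δ, hδ.le⟩ : ℝ≥0) : ℝ) ≤ ‖drivingPt U t - g t‖ :=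
    fun t ht htb ↦ not_lt.1 fun hlt ↦ hcon ⟨t, ht, htb, hlt⟩
  have := h.coe_lt_swallowingTime_of_le_norm_sub hU hb (δ := ⟨δ, hδ.le⟩) hδ hcon'
  rw [hmax] at this
  exact lt_irrefl _ this

/-- **Openness of `{z | t < T_z}` / lower semicontinuity of the swallowing time** for a
continuous driving function (continuous dependence on the initial point: Grönwall on a tube
around the maximal solution plus the extension criterion). Lawler (2005), §4.2 (the domains of
`gₜ` are open). [cite: Lawler2005, §4.2] -/
theorem isOpen_setOf_lt_swallowingTime (hU : Continuous U) (t : ℝ≥0) :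
    IsOpen {z : ℂ | (t : WithTop ℝ≥0) < swallowingTime U z} := by
  rw [Metric.isOpen_iff]
  intro z hz
  obtain ⟨g, hg⟩ := exists_isSolution_swallowingTime hU z
  -- a time `b > t` at which `g` is still alive
  obtain ⟨m, htm, hmT⟩ := exists_between (show (t : WithTop ℝ≥0) < swallowingTime U z from hz)
  have hm : m ≠ ⊤ := ne_top_of_lt hmT
  obtain ⟨b, rfl⟩ := WithTop.ne_top_iff_exists.1 hm
  have htb : t < b := WithTop.coe_lt_coe.1 htm
  have hbT : ((b : ℝ).toNNReal : WithTop ℝ≥0) < swallowingTime U z := by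
    rwa [Real.toNNReal_coe]
  obtain ⟨δ, hδ, hfar⟩ := hg.exists_le_norm_sub hU b.coe_nonneg hbT
  have hδ' : (0 : ℝ) < δ := hδ
  -- the norm bound, the Lipschitz constant on the `δ/2`-tube and the radius `ρ`
  set Mz : ℝ≥0 := ⟨‖z‖ + 3, by positivity⟩ with hMzdef
  set K : ℝ≥0 := (1 + Mz) ^ 2 / (δ / 2) ^ 2 with hKdef
  set ρ : ℝ := min ((δ : ℝ) / 4 * Real.exp (-((K : ℝ) * b))) 1 with hρdef
  have hρ : 0 < ρ := lt_min (by positivity) one_pos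
  have hρle : ρ ≤ (δ : ℝ) / 4 * Real.exp (-((K : ℝ) * b)) := min_le_left _ _
  have hρ1 : ρ ≤ 1 := min_le_right _ _
  have hρδ : ρ ≤ δ / 4 := by
    refine hρle.trans ?_
    have : Real.exp (-((K : ℝ) * b)) ≤ 1 := Real.exp_le_one_iff.2 (by
      have : (0 : ℝ) ≤ K * b := by positivity
      linarith)
    nlinarith
  refine ⟨ρ, hρ, fun z' hz' ↦ ?_⟩
  rw [Metric.mem_ball] at hz'
  obtain ⟨h, hh⟩ := exists_isSolution_swallowingTime hU z'
  by_contra hcon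
  simp only [mem_setOf_eq, not_lt] at hcon
  -- the lifetime `c ≤ t < b` of the maximal solution from `z'`
  have hcT : swallowingTime U z' ≠ ⊤ := ne_top_of_le_ne_top WithTop.coe_ne_top hcon
  obtain ⟨c, hc⟩ := WithTop.ne_top_iff_exists.1 hcT
  rw [← hc] at hh hcon
  have hct : c ≤ t := WithTop.coe_le_coe.1 hcon
  have hcb : (c : ℝ) < b := lt_of_le_of_lt (NNReal.coe_le_coe.2 hct) (NNReal.coe_lt_coe.2 htb)
  -- `z'` is off the singularity, so `0 < c`
  have hz'0 : z' ≠ drivingPt U 0 := by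
    intro h0
    have h1 := hfar 0 ⟨le_rfl, b.coe_nonneg⟩
    rw [hg.apply_zero] at h1
    have h2 : ‖drivingPt U 0 - z‖ ≤ dist z' z := by
      rw [← h0, dist_eq_norm]
    linarith
  have hc0 : 0 < c := by
    have := swallowingTime_pos hU hz'0
    rw [← hc] at this
    exact WithTop.coe_pos.1 this
  -- time domains and norm bounds
  have hDc : ∀ s, s ∈ timeDom (c : WithTop ℝ≥0) ↔ 0 ≤ s ∧ s < c := fun s ↦
    Loewner.mem_timeDomain_coe_iff
  have hsubg : Icc 0 (b : ℝ) ⊆ timeDom (swallowingTime U z) := Loewner.Icc_subset_timeDomain hbT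
  have hz'norm : ‖z'‖ ≤ ‖z‖ + 1 := by
    calc ‖z'‖ = ‖(z' - z) + z‖ := by rw [sub_add_cancel]
      _ ≤ ‖z' - z‖ + ‖z‖ := norm_add_le _ _
      _ ≤ ‖z‖ + 1 := by rw [← dist_eq_norm]; linarith
  have hgM : ∀ s, 0 ≤ s → s ≤ (b : ℝ) → ‖g s‖ ≤ Mz := fun s hs0 hsb ↦ by
    change ‖g s‖ ≤ ‖z‖ + 3
    linarith [hg.norm_le hs0 (hsubg ⟨hs0, hsb⟩).2]
  have hhM : ∀ s, 0 ≤ s → s < (c : ℝ) → ‖h s‖ ≤ Mz := fun s hs0 hsc ↦ by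
    change ‖h s‖ ≤ ‖z‖ + 3
    linarith [hh.norm_le hs0 ((hDc s).2 ⟨hs0, hsc⟩).2]
  -- the tube estimate: `dist (h u) (g u) < δ/2` for `u < c`
  have htube : ∀ u : ℝ, 0 ≤ u → u < c → dist (h u) (g u) < δ / 2 := by
    intro u hu0 huc
    by_contra hnot
    rw [not_lt] at hnot
    have hsubh : Icc 0 u ⊆ timeDom (c : WithTop ℝ≥0) :=
      fun s hs ↦ (hDc s).2 ⟨hs.1, lt_of_le_of_lt hs.2 huc⟩
    have hsubg' : Icc 0 u ⊆ Icc 0 (b : ℝ) := Icc_subset_Icc le_rfl (huc.le.trans hcb.le)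
    have hconth : ContinuousOn h (Icc 0 u) := hh.continuousOn.mono hsubh
    have hcontg : ContinuousOn g (Icc 0 u) := hg.continuousOn.mono (hsubg'.trans hsubg)
    have hcontd : ContinuousOn (fun s ↦ dist (h s) (g s)) (Icc 0 u) :=
      continuous_dist.comp_continuousOn (hconth.prodMk hcontg)
    set S : Set ℝ := Icc 0 u ∩ (fun s ↦ dist (h s) (g s)) ⁻¹' Ici ((δ : ℝ) / 2) with hSdef
    have hS : IsClosed S := hcontd.preimage_isClosed_of_isClosed isClosed_Icc isClosed_Ici
    have huS : u ∈ S := ⟨⟨hu0, le_rfl⟩, hnot⟩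
    have hSbdd : BddBelow S := ⟨0, fun s hs ↦ hs.1.1⟩
    set s₀ := sInf S with hs₀def
    have hs₀S : s₀ ∈ S := hS.csInf_mem ⟨u, huS⟩ hSbdd
    have hs₀0 : 0 ≤ s₀ := hs₀S.1.1
    have hs₀u : s₀ ≤ u := hs₀S.1.2
    have hbefore : ∀ s, 0 ≤ s → s < s₀ → dist (h s) (g s) < δ / 2 := by
      intro s hs0 hss
      by_contra hge
      rw [not_lt] at hge
      have hsS : s ∈ S := ⟨⟨hs0, hss.le.trans hs₀u⟩, hge⟩
      exact absurd (csInf_le hSbdd hsS) (not_le.2 hss)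
    -- Grönwall on `[0, s₀]`
    have hsub0 : Icc 0 s₀ ⊆ Icc 0 u := Icc_subset_Icc le_rfl hs₀u
    have key := dist_le_of_trajectories_ODE_of_mem (v := field U)
      (s := fun t ↦ {w : ℂ | ((δ / 2 : ℝ≥0) : ℝ) ≤ ‖drivingPt U t - w‖ ∧ ‖w‖ ≤ Mz}) (K := K)
      (δ := ρ) (f := g) (g := h) (a := 0) (b := s₀)
      (fun t _ ↦ lipschitzOnWith_field U t (half_pos hδ) Mz)
      (hcontg.mono hsub0) (hg.hasDerivWithinAt_Ici ((hsub0.trans hsubg').trans hsubg))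
      (fun s hs ↦ by
        have hsb : s ≤ (b : ℝ) := hs.2.le.trans (hs₀u.trans (huc.le.trans hcb.le))
        have := hfar s ⟨hs.1, hsb⟩
        refine ⟨?_, hgM s hs.1 hsb⟩
        push_cast
        linarith)
      (hconth.mono hsub0) (hh.hasDerivWithinAt_Ici (hsub0.trans hsubh))
      (fun s hs ↦ by
        have hsb : s ≤ (b : ℝ) := hs.2.le.trans (hs₀u.trans (huc.le.trans hcb.le))
        have h1 := hfar s ⟨hs.1, hsb⟩
        have h2 := hbefore s hs.1 hs.2
        rw [dist_eq_norm] at h2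
        refine ⟨?_, hhM s hs.1 (lt_of_lt_of_le hs.2 (hs₀u.trans huc.le))⟩
        push_cast
        have h3 : ‖drivingPt U s - g s‖ ≤ ‖drivingPt U s - h s‖ + ‖h s - g s‖ := by
          calc ‖drivingPt U s - g s‖ = ‖(drivingPt U s - h s) + (h s - g s)‖ := by ring_nf
            _ ≤ _ := norm_add_le _ _
        linarith)
      (by rw [hg.apply_zero, hh.apply_zero, dist_comm]; exact hz'.le)
    have hend := key s₀ ⟨hs₀0, le_rfl⟩
    rw [sub_zero] at hend
    have hexp : ρ * Real.exp (K * s₀) ≤ δ / 4 := by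
      have hs₀b : s₀ ≤ (b : ℝ) := hs₀u.trans (huc.le.trans hcb.le)
      calc ρ * Real.exp (K * s₀)
          ≤ (δ : ℝ) / 4 * Real.exp (-((K : ℝ) * b)) * Real.exp (K * s₀) := by gcongr
        _ = (δ : ℝ) / 4 * Real.exp (-((K : ℝ) * b) + K * s₀) := by
            rw [mul_assoc, ← Real.exp_add]
        _ ≤ (δ : ℝ) / 4 * 1 := by
            gcongr
            refine Real.exp_le_one_iff.2 ?_
            have : (K : ℝ) * s₀ ≤ K * b := mul_le_mul_of_nonneg_left hs₀b K.coe_nonneg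
            linarith
        _ = δ / 4 := mul_one _
    have hS₀ : (δ : ℝ) / 2 ≤ dist (h s₀) (g s₀) := hs₀S.2
    rw [dist_comm] at hS₀
    linarith
  -- hence `h` stays `δ/2`-away from `ξ` on `[0, c)`, contradicting maximality
  have hfar' : ∀ u : ℝ, 0 ≤ u → u < c → ((δ / 2 : ℝ≥0) : ℝ) ≤ ‖drivingPt U u - h u‖ := by
    intro u hu0 huc
    have h1 := hfar u ⟨hu0, huc.le.trans hcb.le⟩
    have h2 := htube u hu0 huc
    rw [dist_eq_norm] at h2
    push_cast
    have h3 : ‖drivingPt U u - g u‖ ≤ ‖drivingPt U u - h u‖ + ‖h u - g u‖ := by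
      calc ‖drivingPt U u - g u‖ = ‖(drivingPt U u - h u) + (h u - g u)‖ := by ring_nf
        _ ≤ _ := norm_add_le _ _
    linarith
  have := hh.coe_lt_swallowingTime_of_le_norm_sub hU hc0 (half_pos hδ) hfar'
  rw [← hc] at this
  exact lt_irrefl _ this

/-! ### Hulls and domains; the open disc is invariant; the fixed point `0` -/

/-- The hulls `Kₜ` increase with `t`. [folklore] -/
theorem hull_mono (U : ℝ≥0 → ℝ) : Monotone (hull U) :=
  fun _ _ hst _ hz ↦ ⟨hz.1, hz.2.trans (WithTop.coe_le_coe.2 hst)⟩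

/-- `hull U t ⊆ 𝔻`. [folklore] -/
theorem hull_subset (U : ℝ≥0 → ℝ) (t : ℝ≥0) : hull U t ⊆ ball (0 : ℂ) 1 :=
  fun _ hz ↦ hz.1

/-- `domain U t ⊆ 𝔻`. [folklore] -/
theorem domain_subset (U : ℝ≥0 → ℝ) (t : ℝ≥0) : domain U t ⊆ ball (0 : ℂ) 1 :=
  Set.sdiff_subset

/-- Membership in the radial Loewner domain: `z ∈ Uₜ ↔ |z| < 1 ∧ t < T_z`. [folklore] -/
theorem mem_domain_iff (U : ℝ≥0 → ℝ) (t : ℝ≥0) (z : ℂ) :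
    z ∈ domain U t ↔ z ∈ ball (0 : ℂ) 1 ∧ (t : WithTop ℝ≥0) < swallowingTime U z := by
  simp only [domain, hull, Set.mem_sdiff, mem_setOf_eq, not_and, not_le]
  exact ⟨fun h ↦ ⟨h.1, h.2 h.1⟩, fun h ↦ ⟨h.1, fun _ ↦ h.2⟩⟩

/-- The domains decrease with `t`. [folklore] -/
theorem domain_antitone (U : ℝ≥0 → ℝ) : Antitone (domain U) :=
  fun _ _ hst ↦ Set.sdiff_subset_sdiff_right (hull_mono U hst)

/-- **The radial Loewner domains `Uₜ` are open** (continuous driving function):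
`Uₜ = 𝔻 ∩ {z | t < T_z}`. Lawler (2005), §4.2. [cite: Lawler2005, §4.2] -/
theorem isOpen_domain (hU : Continuous U) (t : ℝ≥0) : IsOpen (domain U t) := by
  have : domain U t = ball (0 : ℂ) 1 ∩ {z : ℂ | (t : WithTop ℝ≥0) < swallowingTime U z} := by
    ext z
    rw [mem_domain_iff]
    rfl
  rw [this]
  exact isOpen_ball.inter (isOpen_setOf_lt_swallowingTime hU t)

/-- **The open disc is invariant**: a solution started in `𝔻` stays in `𝔻` (continuous driving
function). On `[0, t]` the solution stays `δ`-away from `ξ` and in the closed disc, so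
`u = 1 - |g|² ≥ 0` satisfies `u̇ = -2|g|² u/|ξ - g|² ≥ -(2/δ²) u`, and `u e^{2s/δ²}` is
non-decreasing, forcing `u(t) > 0`. LSW (2002), p. 5 (`gₜ : Uₜ → 𝕌`). [cite: LawlerSchrammWernerEJP2002, §2 (p. 5)] -/
theorem IsSolution.norm_lt_one (hU : Continuous U) (h : IsSolution U z g T) (hz : ‖z‖ < 1)
    {t : ℝ} (ht : 0 ≤ t) (htT : (t.toNNReal : WithTop ℝ≥0) < T) : ‖g t‖ < 1 := by
  obtain ⟨δ, hδ, hfar⟩ := h.exists_le_norm_sub hU ht htT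
  have hδ' : (0 : ℝ) < δ := hδ
  have hsub : Icc 0 t ⊆ timeDom T := Loewner.Icc_subset_timeDomain htT
  set c : ℝ := 2 / (δ : ℝ) ^ 2 with hcdef
  have hF : ∀ s ∈ Icc 0 t, HasDerivWithinAt
      (fun s ↦ (1 - Complex.normSq (g s)) * Real.exp (c * s))
      ((0 - 2 * (Complex.normSq (g s) *
          ((1 - Complex.normSq (g s)) / Complex.normSq (drivingPt U s - g s)))) *
          Real.exp (c * s) +
        (1 - Complex.normSq (g s)) * (Real.exp (c * s) * (c * 1))) (Icc 0 t) s := by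
    intro s hs
    have h1 : HasDerivWithinAt (fun s ↦ 1 - Complex.normSq (g s))
        (0 - 2 * (Complex.normSq (g s) *
          ((1 - Complex.normSq (g s)) / Complex.normSq (drivingPt U s - g s)))) (Icc 0 t) s :=
      ((hasDerivWithinAt_const s _ 1).sub (h.hasDerivWithinAt_normSq (hsub hs))).mono hsub
    have h2 : HasDerivWithinAt (fun s ↦ Real.exp (c * s)) (Real.exp (c * s) * (c * 1))
        (Icc 0 t) s :=
      ((hasDerivAt_id s).const_mul c).exp.hasDerivWithinAt
    exact h1.mul h2
  have hmono : MonotoneOn (fun s ↦ (1 - Complex.normSq (g s)) * Real.exp (c * s)) (Icc 0 t) := by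
    refine monotoneOn_of_hasDerivWithinAt_nonneg (convex_Icc 0 t)
      (fun s hs ↦ (hF s hs).continuousWithinAt)
      (fun s hs ↦ (hF s (interior_subset hs)).mono interior_subset) fun s hs ↦ ?_
    have hs' : s ∈ Icc 0 t := interior_subset hs
    have hρ1 : Complex.normSq (g s) ≤ 1 := h.normSq_le_one hz.le hs'.1 (hsub hs').2
    have hρ0 : 0 ≤ Complex.normSq (g s) := Complex.normSq_nonneg _
    have hu : 0 ≤ 1 - Complex.normSq (g s) := by linarith
    have hN : (δ : ℝ) ^ 2 ≤ Complex.normSq (drivingPt U s - g s) := by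
      rw [Complex.normSq_eq_norm_sq]
      exact pow_le_pow_left₀ hδ'.le (hfar s hs') 2
    have hN0 : 0 < Complex.normSq (drivingPt U s - g s) := lt_of_lt_of_le (by positivity) hN
    have hrew : (0 - 2 * (Complex.normSq (g s) *
          ((1 - Complex.normSq (g s)) / Complex.normSq (drivingPt U s - g s)))) *
          Real.exp (c * s) +
        (1 - Complex.normSq (g s)) * (Real.exp (c * s) * (c * 1)) =
        Real.exp (c * s) * (1 - Complex.normSq (g s)) *
          (c - 2 * Complex.normSq (g s) / Complex.normSq (drivingPt U s - g s)) := by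
      field_simp
      ring
    rw [hrew]
    refine mul_nonneg (mul_nonneg (Real.exp_pos _).le hu) (sub_nonneg.2 ?_)
    calc 2 * Complex.normSq (g s) / Complex.normSq (drivingPt U s - g s)
        ≤ 2 * 1 / Complex.normSq (drivingPt U s - g s) := by gcongr
      _ ≤ 2 / (δ : ℝ) ^ 2 := by
          rw [mul_one]
          exact div_le_div_of_nonneg_left (by norm_num) (by positivity) hN
  have hend := hmono ⟨le_rfl, ht⟩ ⟨ht, le_rfl⟩ ht
  simp only [mul_zero, Real.exp_zero, mul_one] at hend
  rw [h.apply_zero] at hend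
  have hz' : 0 < 1 - Complex.normSq z := by
    rw [Complex.normSq_eq_norm_sq]
    nlinarith [norm_nonneg z]
  have hpos : 0 < (1 - Complex.normSq (g t)) * Real.exp (c * t) := hz'.trans_le hend
  have hu : 0 < 1 - Complex.normSq (g t) := by
    by_contra hle
    rw [not_lt] at hle
    have := mul_nonpos_of_nonpos_of_nonneg hle (Real.exp_pos (c * t)).le
    linarith
  rw [Complex.normSq_eq_norm_sq] at hu
  exact (sq_lt_one_iff₀ (norm_nonneg _)).1 (by linarith)

/-- **`K₀ = ∅`**: every point of the open disc is off the singularity `ξ₀ ∈ ∂𝔻` and flows for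
a positive time. [folklore] -/
theorem hull_zero (hU : Continuous U) : hull U 0 = ∅ := by
  ext z
  simp only [hull, mem_setOf_eq, mem_empty_iff_false, iff_false, not_and, not_le, mem_ball,
    dist_zero_right]
  intro hz
  simpa using swallowingTime_pos hU (ne_drivingPt_of_norm_lt_one U hz 0)

/-- At time `0` the domain is the whole open disc. [folklore] -/
theorem domain_zero (hU : Continuous U) : domain U 0 = ball (0 : ℂ) 1 := by
  rw [domain, hull_zero hU, Set.sdiff_empty]

/-- **The origin is a fixed point**: the constant curve `0` is a global solution
(`F(t, 0) = 0`). LSW (2002), (2.5)–(2.6): `gₜ(0) = 0`. [cite: LawlerSchrammWernerEJP2002, §2 eq. (2.6)] -/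
theorem isSolution_zero (U : ℝ≥0 → ℝ) : IsSolution U 0 (fun _ ↦ 0) ⊤ := by
  refine ⟨rfl, fun t _ ↦ ?_, fun t _ _ ↦ ne_drivingPt_of_norm_lt_one U (by simp) t⟩
  rw [field_zero]
  exact hasDerivWithinAt_const _ _ _

/-- `T_0 = ⊤`: the origin is never swallowed. [folklore] -/
theorem swallowingTime_zero (U : ℝ≥0 → ℝ) : swallowingTime U 0 = ⊤ :=
  eq_top_iff.2 (isSolution_zero U).le_swallowingTime

/-- `0 ∈ Uₜ` for every `t`. [folklore] -/
theorem zero_mem_domain (U : ℝ≥0 → ℝ) (t : ℝ≥0) : (0 : ℂ) ∈ domain U t := by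
  rw [mem_domain_iff, swallowingTime_zero]
  exact ⟨mem_ball_self one_pos, WithTop.coe_lt_top t⟩

end Flow

end Disc

end RadialLoewner

end Literature.Probability.RandomPlanarGeometry
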